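import Literature.MathematicalPhysics.QuantumLattice.HubbardNNNHoppingFlux
import Literature.MathematicalPhysics.QuantumLattice.HubbardTorusFluxStiffnessResponse
import HarnessLib

/-!
# The f-sum floor of the flux stiffness for the `t–t'` Hubbard torus

Topic `Literature/MathematicalPhysics/QuantumLattice` (family `hubbard`); companion of
`HubbardNNNHoppingFlux.lean` (the twisted `t–t'` torus `hubbardTorusTT'Flux L t' U θ`, its flux
envelope `fluxEnergyTT' L t' U δ θ`) and of `HubbardTorusFluxStiffnessResponse.lean` (the same
chain at `t' = 0`). Everything here is PROVED; no named facts.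

* **Uniform gauge.** Conjugating by the Lieb–Schultz–Mattis twist `W = phaseGauge (twistGauge θ)`
  spreads the seam flux over all bonds: the nearest-neighbour part becomes
  `magneticHubbardTorus L (uniformTwistConfig L θ) 1 U` (tree) and the diagonal part becomes
  `-t' • diagPeierlsHopping L (e^{iθ/L})` — both diagonal jumps `e₁ ± e₂` advance `x₁` by one, so
  they pick up the same phase `e^{iθ/L}` as the `e₁`-bonds (`conj_hubbardTorusTT'Flux_eq_uniform`,
  `L ≥ 3`); sector energies are gauge invariant (`fluxEnergyTT'_eq_minEnergyOn_uniform`).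
* **Rayleigh expansion** (Watanabe 2019 §2.2.1 eqs. (13)–(16) for the `t–t'` band): for every unit
  vector `ψ` of the sector, `E^{tt'}(θ) ≤ Re⟨ψ, H^{tt'} ψ⟩ + 2(1 − cos(θ/L)) (K_x + t' K_d)(ψ)
  + 2 sin(θ/L) (J_x + t' J_d)(ψ)` with `K_x = Σ_{x,σ} Re⟨c†_{x+e₁,σ} c_{x,σ}⟩`,
  `K_d = Σ_{s,x,σ} Re⟨c†_{x+j_s,σ} c_{x,σ}⟩` and `J_x`, `J_d` the imaginary parts
  (`fluxEnergyTT'_le_rayleigh_uniformTwist`).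
* **f-sum floor** (Scalapino–White–Zhang 1993 §II; Paramekanti–Trivedi–Randeria 1998 eq. (3);
  Hazra–Verma–Randeria 2019 eqs. (2)–(4): `D_s ≤ D̃ ∝ ⟨−K_x⟩` with `Σ_{bonds} t_b (Δx_b)² …`, the
  diagonal bonds entering with `(Δx)² = 1`): if `E^{tt'}(θ) − E^{tt'}(0) ≥ ρ_s θ²` for `|θ| ≤ θ₀`
  then every zero-flux sector ground state has `ρ_s L² ≤ K_x(ψ) + t' K_d(ψ)`
  (`stiffnessTT'_mul_sq_le_kinetic_of_isGroundStateInSector`), after the `±θ` average that kills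
  the current term (`E(−θ) = E(θ)`, Byers–Yang).

References: D. J. Scalapino, S. R. White, S. C. Zhang, PRB 47 (1993) 7995, §II
[ScalapinoWhiteZhang1993]; A. Paramekanti, N. Trivedi, M. Randeria, PRB 57 (1998) 11639, eq. (3)
[ParamekantiTrivediRanderia1998]; T. Hazra, N. Verma, M. Randeria, PRX 9 (2019) 031049,
eqs. (2)–(4) [HazraVermaRanderia2019]; H. Watanabe, J. Stat. Phys. 177 (2019) 717, §2.2.1–§2.2.3,
§4.1 [Watanabe2019]; E. H. Lieb, PRL 73 (1994) 2158, eq. (1) [Lieb1994]; N. Byers, C. N. Yang,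
PRL 7 (1961) 46 [ByersYang1961].
-/

noncomputable section

namespace Literature.MathematicalPhysics.QuantumLattice

open Matrix Finset Literature.MathematicalPhysics.QuantumFieldTheory
  Literature.Probability.LatticeModels
open scoped ComplexConjugate

variable {L : ℕ} [NeZero L]

/-! ### The uniform gauge for the diagonal bonds -/

omit [NeZero L] in
/-- The twist gauge at the end of a diagonal bond depends only on the first coordinate:
`g(x + j_s) = g(x + e₁)`. [folklore] -/
private theorem twistGauge_add_torusDiagJump (θ : ℝ) (x : Site 2 L) (s : Fin 2) :
    twistGauge L θ (x + torusDiagJump L s) = twistGauge L θ (x.shift 0) := by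
  have h : (x + torusDiagJump L s) 0 = (x.shift 0) 0 := by
    rw [Pi.add_apply, shift_zero_apply_zero]
    simp [torusDiagJump]
  simp only [twistGauge, h]

omit [NeZero L] in
/-- The gauge-transformed seam amplitude of a diagonal bond is the uniform twist `e^{iθ/L}`
(`L ≥ 2`). [folklore] -/
private theorem twistGauge_mul_seam_mul_conj_diag (hL : 2 ≤ L) (θ : ℝ) (x : Site 2 L) (s : Fin 2) :
    ((twistGauge L θ x : Circle) : ℂ) * ((seamFluxConfig L θ (x, 0) : Circle) : ℂ) *
        conj ((twistGauge L θ (x + torusDiagJump L s) : Circle) : ℂ) =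
      ((Circle.exp (θ / L) : Circle) : ℂ) := by
  have h := congrFun (gaugeTransform_twistGauge_seamFluxConfig hL θ) (x, 0)
  rw [uniformTwistConfig_apply, if_pos rfl] at h
  rw [twistGauge_add_torusDiagJump, ← Circle.coe_inv_eq_conj, ← Circle.coe_mul, ← Circle.coe_mul, ← h]
  rfl

/-- **Site-phase gauge transformation of a diagonal Peierls bond sum**: conjugating by
`W_g = phaseGauge g` multiplies the amplitude of the bond `x → x + j_s` by `g(x) conj g(x + j_s)`
(Lieb 1994, gauge invariance of eq. (1); Watanabe 2019 §2.2.1, `U H U†`). [cite: Watanabe2019, §2.2.1] -/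
theorem conjTranspose_phaseGauge_mul_diagPeierlsHopping_mul_phaseGauge (g : Site 2 L → Circle)
    (a : Fin 2 → Site 2 L → ℂ) :
    (phaseGauge fun u : FermionTorus 2 L => g u.toTorusSite)ᴴ * diagPeierlsHopping L a *
        phaseGauge (fun u : FermionTorus 2 L => g u.toTorusSite) =
      diagPeierlsHopping L fun s x =>
        (g x : ℂ) * a s x * conj ((g (x + torusDiagJump L s) : Circle) : ℂ) := by
  have hW : (phaseGauge fun u : FermionTorus 2 L => g u.toTorusSite) =
      (phaseGauge fun u : FermionTorus 2 L => (g u.toTorusSite)⁻¹)ᴴ := by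
    rw [phaseGauge_conjTranspose]
    congr 1
    funext u
    simp only [Pi.inv_apply, inv_inv]
  rw [hW, conjTranspose_conjTranspose]
  unfold diagPeierlsHopping
  rw [Finset.mul_sum, Finset.sum_mul]
  refine Finset.sum_congr rfl fun s _ => ?_
  rw [Finset.mul_sum, Finset.sum_mul]
  refine Finset.sum_congr rfl fun x _ => ?_
  rw [Finset.mul_sum, Finset.sum_mul]
  refine Finset.sum_congr rfl fun σ _ => ?_
  rw [Matrix.mul_add, Matrix.add_mul, Matrix.mul_smul, Matrix.smul_mul, Matrix.mul_smul,
    Matrix.smul_mul, phaseGauge_mul_mul_mul_conjTranspose, phaseGauge_mul_creation_mul_conjTranspose,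
    phaseGauge_mul_annihilation_mul_conjTranspose, smul_mul_smul, smul_smul,
    phaseGauge_mul_mul_mul_conjTranspose, phaseGauge_mul_creation_mul_conjTranspose,
    phaseGauge_mul_annihilation_mul_conjTranspose, smul_mul_smul, smul_smul]
  simp only [FermionTorus.toTorusSite_ofTorusSite, Circle.coe_inv_eq_conj, map_mul, Complex.conj_conj]
  congr 2 <;> ring

/-- **The twisted `t–t'` torus in the uniform gauge** (`L ≥ 3`): conjugated by the twist
`W = phaseGauge (twistGauge θ)` it is the uniformly twisted nearest-neighbour torus plus the diagonal
hopping with the uniform Peierls phase `e^{iθ/L}` on every bond `x → x + j_s` (Watanabe 2019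
§2.2.1–§2.2.3: `U_m† H U_m = H^{(2πm/L,…)}`; §4.1). [cite: Watanabe2019, §2.2.3 and §4.1] -/
theorem conj_hubbardTorusTT'Flux_eq_uniform (hL : 3 ≤ L) (t' U θ : ℝ) :
    (phaseGauge fun u : FermionTorus 2 L => twistGauge L θ u.toTorusSite)ᴴ *
          hubbardTorusTT'Flux L t' U θ *
        phaseGauge (fun u : FermionTorus 2 L => twistGauge L θ u.toTorusSite) =
      magneticHubbardTorus L (uniformTwistConfig L θ) 1 U +
        -(t' : ℂ) • diagPeierlsHopping L (fun _ _ => ((Circle.exp (θ / L) : Circle) : ℂ)) := by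
  rw [hubbardTorusTT'Flux_eq_hubbardTorusFlux_add, hamiltonianDiag_add_smul_diagSeamTwist hL,
    Matrix.mul_add, Matrix.add_mul, ← magneticHubbardTorus_uniformTwistConfig_eq_conj_hubbardTorusFlux hL,
    Matrix.mul_smul, Matrix.smul_mul, conjTranspose_phaseGauge_mul_diagPeierlsHopping_mul_phaseGauge]
  congr 3
  funext s x
  exact twistGauge_mul_seam_mul_conj_diag (by omega) θ x s

/-- **Gauge invariance of the `t–t'` flux envelope** (`L ≥ 3`): `E^{tt'}_L(θ)` is the lowest sector
energy of the uniformly twisted `t–t'` torus. [cite: Watanabe2019, §2.2.3 and §4.1] -/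
theorem fluxEnergyTT'_eq_minEnergyOn_uniform (hL : 3 ≤ L) (t' U δ θ : ℝ) :
    fluxEnergyTT' L t' U δ θ =
      (magneticHubbardTorus L (uniformTwistConfig L θ) 1 U +
          -(t' : ℂ) • diagPeierlsHopping L (fun _ _ => ((Circle.exp (θ / L) : Circle) : ℂ))).minEnergyOn
        (szSector (2 * ⌊(1 - δ) * (L : ℝ) ^ 2 / 2⌋₊) 0) := by
  rw [← conj_hubbardTorusTT'Flux_eq_uniform hL, minEnergyOn_szSector_phaseGauge_conj, fluxEnergyTT'_eq]

/-! ### Peierls amplitudes in expectation -/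

/-- `Re[a h + conj a · conj h] = 2 (Re a Re h − Im a Im h)`. [folklore] -/
private theorem re_peierls_pair (a h : ℂ) :
    (a * h + conj a * (starRingEnd ℂ) h).re = 2 * a.re * h.re - 2 * a.im * h.im := by
  simp only [Complex.add_re, Complex.mul_re, Complex.conj_re, Complex.conj_im]
  ring

/-- Bookkeeping: `Σ_{s,x,σ} (2c R − 2d I) = 2c Σ R − 2d Σ I`. [folklore] -/
private theorem sum3_rearrange (c d : ℝ) (R I : Fin 2 → Site 2 L → Fin 2 → ℝ) :
    (∑ s : Fin 2, ∑ x : Site 2 L, ∑ σ : Fin 2, (2 * c * R s x σ - 2 * d * I s x σ)) =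
      2 * c * (∑ s : Fin 2, ∑ x : Site 2 L, ∑ σ : Fin 2, R s x σ) -
        2 * d * ∑ s : Fin 2, ∑ x : Site 2 L, ∑ σ : Fin 2, I s x σ := by
  simp only [Finset.sum_sub_distrib, Finset.mul_sum]

/-- **A diagonal Peierls bond sum with constant amplitude in expectation**:
`Re⟨φ, D_a φ⟩ = 2 Re a · K_d(φ) − 2 Im a · J_d(φ)` with `K_d = Σ_{s,x,σ} Re h`, `J_d = Σ Im h`,
`h = ⟨φ, c†_{x+j_s,σ} c_{x,σ} φ⟩` (Watanabe 2019 §2.2.1 eqs. (13)–(16): the bond kinetic weights and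
bond currents of the twisted Hamiltonian). [cite: Watanabe2019, §2.2.1] -/
theorem re_star_dotProduct_diagPeierlsHopping_const_mulVec (a : ℂ) (φ : Fock (Orb (FermionTorus 2 L))) :
    (star φ ⬝ᵥ (diagPeierlsHopping L (fun _ _ => a) *ᵥ φ)).re =
      2 * a.re * (∑ s : Fin 2, ∑ x : Site 2 L, ∑ σ : Fin 2,
          (star φ ⬝ᵥ ((creation (orb (FermionTorus.ofTorusSite (x + torusDiagJump L s)) σ) *
            annihilation (orb (FermionTorus.ofTorusSite x) σ)) *ᵥ φ)).re) -
        2 * a.im * ∑ s : Fin 2, ∑ x : Site 2 L, ∑ σ : Fin 2,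
          (star φ ⬝ᵥ ((creation (orb (FermionTorus.ofTorusSite (x + torusDiagJump L s)) σ) *
            annihilation (orb (FermionTorus.ofTorusSite x) σ)) *ᵥ φ)).im := by
  rw [← sum3_rearrange]
  unfold diagPeierlsHopping
  simp only [Matrix.sum_mulVec, dotProduct_sum, Complex.re_sum]
  refine Finset.sum_congr rfl fun s _ => Finset.sum_congr rfl fun x _ =>
    Finset.sum_congr rfl fun σ _ => ?_
  rw [add_mulVec, dotProduct_add, smul_mulVec, smul_mulVec, dotProduct_smul, dotProduct_smul,
    smul_eq_mul, smul_eq_mul, star_dotProduct_creation_mul_annihilation_mulVec_swap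
      (orb (FermionTorus.ofTorusSite (x + torusDiagJump L s)) σ) (orb (FermionTorus.ofTorusSite x) σ)]
  exact re_peierls_pair _ _

/-! ### The Rayleigh expansion in the flux and the f-sum floor -/

/-- **Pricing the flux with the uniform twist, `t–t'` torus** (`L ≥ 3`): for every unit vector `ψ`
of the sector `(N_L, 0)`,
`E^{tt'}(θ) ≤ Re⟨ψ, H^{tt'} ψ⟩ + 2(1 − cos(θ/L)) (K_x + t' K_d)(ψ) + 2 sin(θ/L) (J_x + t' J_d)(ψ)`,
`K_x = Σ_{x,σ} Re⟨c†_{x+e₁,σ} c_{x,σ}⟩_ψ`, `K_d = Σ_{s,x,σ} Re⟨c†_{x+j_s,σ} c_{x,σ}⟩_ψ`, `J_x, J_d` the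
imaginary parts — Watanabe (2019) §2.2.1 eqs. (13)–(16) for a band with next-nearest-neighbour
hopping (each diagonal bond advances `x₁` by one). [cite: Watanabe2019, §2.2.3 and §4.1] -/
theorem fluxEnergyTT'_le_rayleigh_uniformTwist (hL : 3 ≤ L) (t' U δ θ : ℝ)
    (ψ : Fock (Orb (FermionTorus 2 L)))
    (hψ : ψ ∈ szSector (2 * ⌊(1 - δ) * (L : ℝ) ^ 2 / 2⌋₊) 0) (h1 : star ψ ⬝ᵥ ψ = 1) :
    fluxEnergyTT' L t' U δ θ ≤ (star ψ ⬝ᵥ (hubbardTorusTT' L 1 t' U *ᵥ ψ)).re +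
      2 * (1 - Real.cos (θ / L)) *
        ((∑ x : Site 2 L, ∑ σ : Fin 2,
            (star ψ ⬝ᵥ ((creation (orb (FermionTorus.ofTorusSite (Site.shift x 0)) σ) *
              annihilation (orb (FermionTorus.ofTorusSite x) σ)) *ᵥ ψ)).re) +
          t' * ∑ s : Fin 2, ∑ x : Site 2 L, ∑ σ : Fin 2,
            (star ψ ⬝ᵥ ((creation (orb (FermionTorus.ofTorusSite (x + torusDiagJump L s)) σ) *
              annihilation (orb (FermionTorus.ofTorusSite x) σ)) *ᵥ ψ)).re) +
      2 * Real.sin (θ / L) *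
        ((∑ x : Site 2 L, ∑ σ : Fin 2,
            (star ψ ⬝ᵥ ((creation (orb (FermionTorus.ofTorusSite (Site.shift x 0)) σ) *
              annihilation (orb (FermionTorus.ofTorusSite x) σ)) *ᵥ ψ)).im) +
          t' * ∑ s : Fin 2, ∑ x : Site 2 L, ∑ σ : Fin 2,
            (star ψ ⬝ᵥ ((creation (orb (FermionTorus.ofTorusSite (x + torusDiagJump L s)) σ) *
              annihilation (orb (FermionTorus.ofTorusSite x) σ)) *ᵥ ψ)).im) := by
  have hH : (magneticHubbardTorus L (uniformTwistConfig L θ) 1 U +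
      -(t' : ℂ) • diagPeierlsHopping L (fun _ _ => ((Circle.exp (θ / L) : Circle) : ℂ))).IsHermitian := by
    rw [← conj_hubbardTorusTT'Flux_eq_uniform hL]
    exact Matrix.isHermitian_conjTranspose_mul_mul _ (isHermitian_hubbardTorusTT'Flux L t' U θ)
  rw [fluxEnergyTT'_eq_minEnergyOn_uniform hL]
  refine (minEnergyOn_le_rayleigh_of_mem hH _ hψ h1).trans_eq ?_
  have hcoe : ((Circle.exp (θ / L) : Circle) : ℂ) = Complex.exp (((θ / L : ℝ) : ℂ) * Complex.I) :=
    Circle.coe_exp _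
  rw [add_mulVec, dotProduct_add, Complex.add_re,
    re_star_dotProduct_magneticHubbardTorus_uniformTwistConfig_mulVec,
    magneticHubbardTorus_one_eq_hubbardTorus hL, smul_mulVec, dotProduct_smul, smul_eq_mul,
    ← Complex.ofReal_neg, Complex.re_ofReal_mul, re_star_dotProduct_diagPeierlsHopping_const_mulVec,
    hubbardTorusTT', hamiltonian_fermionTorusDiagGraph_eq_smul_diagPeierlsHopping hL, Complex.ofReal_zero,
    zero_smul, add_zero, add_mulVec, dotProduct_add, Complex.add_re, smul_mulVec, dotProduct_smul,
    smul_eq_mul, ← Complex.ofReal_neg, Complex.re_ofReal_mul,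
    re_star_dotProduct_diagPeierlsHopping_const_mulVec, hcoe, Complex.exp_ofReal_mul_I_re,
    Complex.exp_ofReal_mul_I_im, Complex.one_re, Complex.one_im, hubbardTorus]
  ring

/-- A zero-flux `(N_L, 0)`-sector ground state of the `t–t'` torus realises the zero-flux envelope
value: `Re⟨ψ, H^{tt'} ψ⟩ = E^{tt'}_L(0)`. [cite: ScalapinoWhiteZhang1993, §II] -/
theorem re_star_dotProduct_mulVec_eq_fluxEnergyTT'_zero (t' U δ : ℝ)
    {ψ : Fock (Orb (FermionTorus 2 L))}
    (hgs : IsGroundStateInSector (hubbardTorusTT' L 1 t' U) (2 * ⌊(1 - δ) * (L : ℝ) ^ 2 / 2⌋₊) 0 ψ)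
    (h1 : star ψ ⬝ᵥ ψ = 1) :
    (star ψ ⬝ᵥ (hubbardTorusTT' L 1 t' U *ᵥ ψ)).re = fluxEnergyTT' L t' U δ 0 := by
  obtain ⟨-, -, hH⟩ := hgs
  rw [hH, dotProduct_smul, h1, smul_eq_mul, mul_one, Complex.ofReal_re, fluxEnergyTT'_eq,
    hubbardTorusTT'Flux_zero]

/-- **The `±θ` average for a sector ground state of the `t–t'` torus** (`L ≥ 3`):
`E^{tt'}_L(θ) − E^{tt'}_L(0) ≤ 2(1 − cos(θ/L)) (K_x(ψ) + t' K_d(ψ))` — price `ψ` at `±θ`, use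
`E(−θ) = E(θ)` (Byers–Yang); the current term cancels. This is the variational (f-sum) bound on the
flux response by the band kinetic energy, `D ≤ Σ_b t_b (Δx_b)² ⟨c†c + h.c.⟩`, of
Scalapino–White–Zhang 1993 §II / Paramekanti–Trivedi–Randeria 1998 eq. (3) /
Hazra–Verma–Randeria 2019 eqs. (2)–(4), for the `t–t'` band at `T = 0`.
[cite: HazraVermaRanderia2019, eqs. (2)–(4)] -/
theorem fluxEnergyTT'_sub_le_kinetic_of_isGroundStateInSector (hL : 3 ≤ L) (t' U δ θ : ℝ)
    {ψ : Fock (Orb (FermionTorus 2 L))}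
    (hgs : IsGroundStateInSector (hubbardTorusTT' L 1 t' U) (2 * ⌊(1 - δ) * (L : ℝ) ^ 2 / 2⌋₊) 0 ψ)
    (h1 : star ψ ⬝ᵥ ψ = 1) :
    fluxEnergyTT' L t' U δ θ - fluxEnergyTT' L t' U δ 0 ≤
      2 * (1 - Real.cos (θ / L)) *
        ((∑ x : Site 2 L, ∑ σ : Fin 2,
            (star ψ ⬝ᵥ ((creation (orb (FermionTorus.ofTorusSite (Site.shift x 0)) σ) *
              annihilation (orb (FermionTorus.ofTorusSite x) σ)) *ᵥ ψ)).re) +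
          t' * ∑ s : Fin 2, ∑ x : Site 2 L, ∑ σ : Fin 2,
            (star ψ ⬝ᵥ ((creation (orb (FermionTorus.ofTorusSite (x + torusDiagJump L s)) σ) *
              annihilation (orb (FermionTorus.ofTorusSite x) σ)) *ᵥ ψ)).re) := by
  have hp := fluxEnergyTT'_le_rayleigh_uniformTwist hL t' U δ θ ψ hgs.1 h1
  have hm := fluxEnergyTT'_le_rayleigh_uniformTwist hL t' U δ (-θ) ψ hgs.1 h1
  rw [re_star_dotProduct_mulVec_eq_fluxEnergyTT'_zero t' U δ hgs h1] at hp hm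
  rw [neg_div, Real.cos_neg, Real.sin_neg, fluxEnergyTT'_neg] at hm
  linarith

/-- **The f-sum floor of a flux stiffness, `t–t'` torus** (`L ≥ 3`): if
`E^{tt'}_L(θ) − E^{tt'}_L(0) ≥ ρ_s θ²` for `|θ| ≤ θ₀`, then every zero-flux `(N_L, 0)`-sector ground
state `ψ` of `hubbardTorusTT' L 1 t' U` has `x`-kinetic weight `K_x(ψ) + t' K_d(ψ) ≥ ρ_s L²`
(`2(1 − cos u) ≤ u²` at `u = θ₀/L`). Contrapositive: `ρ_s ≤ (K_x + t' K_d)/L²`, the kinetic-energy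
(optical f-sum) bound on the superfluid stiffness of the `t–t'` band — Scalapino–White–Zhang 1993
§II, Paramekanti–Trivedi–Randeria 1998 eq. (3), Hazra–Verma–Randeria 2019 eqs. (2)–(4) — as a
theorem about sector ground states at `T = 0`. [cite: HazraVermaRanderia2019, eqs. (2)–(4)] -/
theorem stiffnessTT'_mul_sq_le_kinetic_of_isGroundStateInSector (hL : 3 ≤ L) (t' U δ : ℝ)
    {ρs θ₀ : ℝ} (hρs : 0 < ρs) (hθ₀ : 0 < θ₀)
    (hstiff : ∀ θ : ℝ, |θ| ≤ θ₀ →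
      ρs * θ ^ 2 ≤ fluxEnergyTT' L t' U δ θ - fluxEnergyTT' L t' U δ 0)
    {ψ : Fock (Orb (FermionTorus 2 L))}
    (hgs : IsGroundStateInSector (hubbardTorusTT' L 1 t' U) (2 * ⌊(1 - δ) * (L : ℝ) ^ 2 / 2⌋₊) 0 ψ)
    (h1 : star ψ ⬝ᵥ ψ = 1) :
    ρs * (L : ℝ) ^ 2 ≤
      (∑ x : Site 2 L, ∑ σ : Fin 2,
          (star ψ ⬝ᵥ ((creation (orb (FermionTorus.ofTorusSite (Site.shift x 0)) σ) *
            annihilation (orb (FermionTorus.ofTorusSite x) σ)) *ᵥ ψ)).re) +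
        t' * ∑ s : Fin 2, ∑ x : Site 2 L, ∑ σ : Fin 2,
          (star ψ ⬝ᵥ ((creation (orb (FermionTorus.ofTorusSite (x + torusDiagJump L s)) σ) *
            annihilation (orb (FermionTorus.ofTorusSite x) σ)) *ᵥ ψ)).re := by
  set K : ℝ := (∑ x : Site 2 L, ∑ σ : Fin 2,
      (star ψ ⬝ᵥ ((creation (orb (FermionTorus.ofTorusSite (Site.shift x 0)) σ) *
        annihilation (orb (FermionTorus.ofTorusSite x) σ)) *ᵥ ψ)).re) +
    t' * ∑ s : Fin 2, ∑ x : Site 2 L, ∑ σ : Fin 2,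
      (star ψ ⬝ᵥ ((creation (orb (FermionTorus.ofTorusSite (x + torusDiagJump L s)) σ) *
        annihilation (orb (FermionTorus.ofTorusSite x) σ)) *ᵥ ψ)).re with hK
  have hL0 : (0 : ℝ) < L := Nat.cast_pos.2 (NeZero.pos L)
  have hav := fluxEnergyTT'_sub_le_kinetic_of_isGroundStateInSector hL t' U δ θ₀ hgs h1
  rw [← hK] at hav
  have hE := hstiff θ₀ (by rw [abs_of_pos hθ₀])
  have h2 : ρs * θ₀ ^ 2 ≤ 2 * (1 - Real.cos (θ₀ / L)) * K := hE.trans hav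
  have hc : 0 ≤ 1 - Real.cos (θ₀ / L) := sub_nonneg.2 (Real.cos_le_one _)
  have hθ2 : 0 < θ₀ ^ 2 := by positivity
  have hKpos : 0 ≤ K := by
    by_contra hneg
    have hneg' : K < 0 := lt_of_not_ge hneg
    have : 2 * (1 - Real.cos (θ₀ / L)) * K ≤ 0 :=
      mul_nonpos_of_nonneg_of_nonpos (by positivity) hneg'.le
    nlinarith
  have hstep : 2 * (1 - Real.cos (θ₀ / L)) * K ≤ (θ₀ / L) ^ 2 * K :=
    two_mul_one_sub_cos_mul_le _ _ hKpos
  have h3 : ρs * θ₀ ^ 2 ≤ θ₀ ^ 2 / (L : ℝ) ^ 2 * K := by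
    have := h2.trans hstep
    rwa [div_pow] at this
  rw [div_mul_eq_mul_div, le_div_iff₀ (by positivity)] at h3
  nlinarith

end Literature.MathematicalPhysics.QuantumLattice
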